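import Summits.Ventures.DiscreteObjects.Hadamard.SignedMultiplierTMatrices668Final

/-!
# Circulant T-matrices of odd order with a reversal symmetry: the general classification (kernel)

Framing: lottery ticket; floor = certified bounds/negative ranges.

Cell pub-namedobj (venture DiscreteObjects), target (H), hadamard gen 25 — the order-free form of the census of
`SignedMultiplierTMatrices668{,Census,Final}`.  Let `t` be first rows of circulant T-matrices of ODD order `n > 1` with a
signed/permuted multiplier `-1`: `t_{π k}(-x) = ε_k t_k(x)` (`π ∈ S₄`, `ε_k = ±1`).  Then (kernel, every odd `n`):
* `fin4_eq_of_distinct` / the `S₄` trichotomy: the row `k₀` through `0` is fixed, and on the other rows `π` is the identity,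
  a `3`-cycle, or a transposition;
* identity — impossible (`no_signedSymmetric_tMatrixRows_odd`, part III);
* **`no_threeCycle_negMultiplier_odd`** — a `3`-cycle is impossible at every odd order: the cycled rows have equal supports,
  hence vanish, leaving one symmetric `±1` row, which the parity lemma forbids;
* **`negMultiplier_swap_structure_odd`** — for a transposition `(k₁ k₂)`: PARITY (`PAF(2c) ≡ t(c)²` for symmetric/skew rows)
  forces the fourth row to VANISH and the row through `0` to be `±δ₀`; then `PAF_{t_{k₁}}(s) = 0` for all `s ≠ 0` and the
  grammar gives `n = 2a² + 1` with `a = Σ_x t_{k₁}(x)`;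
* **`negMultiplier_odd_classification`**, **`negMultiplier_odd_order`** — so circulant T-matrices of odd order `n > 1` with a
  signed/permuted multiplier `-1` have the shape `(±δ₀, t, ε t*, 0)` with `t` a `±1`-function on a half-set `S`
  (`S ⊔ -S = ℤ_n ∖ {0}`) of PERFECT periodic autocorrelation, and `n = 2a² + 1` (a necessary condition: `n ∈ {3, 9, 19, 33,
  51, …}`; a brute-force check OUTSIDE the kernel finds no such half-sequence for `n = 9, 19`);
  conversely `tmatrixRows_of_perfect_halfSeq` — every such `t` gives T-matrix rows with the symmetry (e.g. `n = 3`: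
  `(δ₀, δ₁, δ₂, 0)`, `tmatrixRows_three_example`);
* `no_negMultiplier_tMatrixRows_167'` — at `n = 167`: `166 = 2a²` has no solution — a second, table-free proof of part III;
* `tseq_five_example` / `no_negMultiplier_tMatrixRows_five` — sanity pair at order `5`: T-sequences exist (SY Example 1.28)
  but no circulant T-matrices of order 5 carry a multiplier `-1` (`5 ≠ 2a² + 1`);
* `reversal_tSeq_odd_order`, **`no_reversalSymmetric_tSeq_odd`** — the aperiodic reading: reversal symmetries
  `t_{π k}(n - 1 - i) = ε_k t_k(i)` of T-sequences of odd length `n > 1` force `n = 2a² + 1`, and four reversal-symmetric or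
  reversal-skew sequences are impossible at every odd length `n > 1`.
Ours, elementary; no `sorry`; no Hadamard order excluded; H(668) untouched; HITS 0/4.
-/

open Finset BigOperators

namespace Summit.Ventures.DiscreteObjects.Hadamard

open Literature.Combinatorics.Designs.LegendrePairs (PAF)
open Literature.Combinatorics.Designs.TSequences
open Literature.Combinatorics.Designs.TMatrices

/-! ## §14 Four distinct letters exhaust `Fin 4` -/
/-- four pairwise distinct letters exhaust `Fin 4`. -/
lemma fin4_eq_of_distinct {k₀ k₁ k₂ k₃ : Fin 4} (h01 : k₀ ≠ k₁) (h02 : k₀ ≠ k₂) (h03 : k₀ ≠ k₃) (h12 : k₁ ≠ k₂)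
    (h13 : k₁ ≠ k₃) (h23 : k₂ ≠ k₃) (k : Fin 4) : k = k₀ ∨ k = k₁ ∨ k = k₂ ∨ k = k₃ := by
  have huniv : ({k₀, k₁, k₂, k₃} : Finset (Fin 4)) = univ := by
    apply Finset.eq_univ_of_card
    rw [Finset.card_insert_of_notMem (by simp [h01, h02, h03]), Finset.card_insert_of_notMem (by simp [h12, h13]),
      Finset.card_insert_of_notMem (by simp [h23]), Finset.card_singleton, Fintype.card_fin]
  have hmem : k ∈ ({k₀, k₁, k₂, k₃} : Finset (Fin 4)) := by rw [huniv]; exact mem_univ k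
  simpa using hmem

/-! ## §15 Odd order: the `3`-cycle and the transposition -/

section OddOrder

variable {n : ℕ} [NeZero n] {t : Fin 4 → ZMod n → ℤ} {π : Equiv.Perm (Fin 4)} {ε : Fin 4 → ℤ}

/-- **no `3`-cycle at any odd order `n > 1`**: if `π` cycles three rows `k₁ → k₂ → k₃ → k₁` then `t_{k₃} = ±t_{k₁}` pointwise,
so the (disjoint) supports force `t_{k₁} = t_{k₂} = t_{k₃} = 0`, and the remaining row is a symmetric `±1` row — impossible by
parity (`no_signedSymmetric_tMatrixRows_odd`). -/
theorem no_threeCycle_negMultiplier_odd (hn : n % 2 = 1) (h1 : 1 < n) (ht : IsTMatrixRows n t)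
    (hε : ∀ k, ε k = 1 ∨ ε k = -1) (hmul : ∀ k x, t (π k) (-x) = ε k * t k x) {k₁ k₂ k₃ : Fin 4} (h13 : k₁ ≠ k₃)
    (c1 : π k₁ = k₂) (c2 : π k₂ = k₃) (c3 : π k₃ = k₁) : False := by
  have r1 : ∀ x, t k₂ (-x) = ε k₁ * t k₁ x := fun x => by rw [← hmul k₁ x, c1]
  have r2 : ∀ x, t k₃ (-x) = ε k₂ * t k₂ x := fun x => by rw [← hmul k₂ x, c2]
  have e31 : ∀ y, t k₃ y = ε k₂ * ε k₁ * t k₁ y := fun y => by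
    have e := r2 (-y)
    rw [neg_neg] at e
    rw [e, r1 y, mul_assoc]
  -- the supports of rows `k₁` and `k₃` coincide, hence are empty
  have z1 : ∀ y, t k₁ y = 0 := fun y => by
    by_contra hy
    obtain ⟨k, -, huniq⟩ := ht.1 y
    have e1 : k₁ = k := by
      by_contra hne
      exact hy (huniq k₁ hne)
    have hy3 : t k₃ y ≠ 0 := by
      rw [e31 y]
      rcases hε k₂ with a | a <;> rcases hε k₁ with b | b <;> simp [a, b, hy]
    have e3 : k₃ = k := by
      by_contra hne
      exact hy3 (huniq k₃ hne)
    exact h13 (e1.trans e3.symm)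
  have z2 : ∀ y, t k₂ y = 0 := fun y => by
    have e := r1 (-y)
    rw [neg_neg] at e
    rw [e, z1, mul_zero]
  have z3 : ∀ y, t k₃ y = 0 := fun y => by rw [e31, z1, mul_zero]
  -- the row through `0` is fixed by `π`
  obtain ⟨k₀, hk₀, -⟩ := ht.1 0
  have hk₀ne : t k₀ 0 ≠ 0 := by rcases hk₀ with e | e <;> simp [e]
  obtain ⟨hπ₀, hε₀⟩ := fixed_of_negMultiplier ht hε hmul hk₀ne
  have h01 : k₀ ≠ k₁ := fun e => hk₀ne (by rw [e]; exact z1 0)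
  have h02 : k₀ ≠ k₂ := fun e => hk₀ne (by rw [e]; exact z2 0)
  have h03 : k₀ ≠ k₃ := fun e => hk₀ne (by rw [e]; exact z3 0)
  have h12 : k₁ ≠ k₂ := fun e => by
    -- `π k₁ = k₂ = k₁` would make `k₁` fixed, then `k₃ = π k₂ = π k₁ = k₂ = k₁`
    apply h13
    rw [← c2, ← e, c1, ← e]
  have h23 : k₂ ≠ k₃ := fun e => by
    apply h13
    rw [← c3, ← e, c2, e]
  -- every row is symmetric or skew (the three cycled rows vanish)
  refine no_signedSymmetric_tMatrixRows_odd hn h1 ht (ε := fun k => if k = k₀ then ε k₀ else 1)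
    (fun k => ?_) (fun k x => ?_)
  · by_cases h : k = k₀
    · rw [if_pos h]; exact hε k₀
    · rw [if_neg h]; exact Or.inl rfl
  · rcases fin4_eq_of_distinct h01 h02 h03 h12 h13 h23 k with rfl | rfl | rfl | rfl
    · rw [if_pos rfl]
      have e := hmul k x
      rw [hπ₀] at e
      exact e
    · simp only [if_neg (Ne.symm h01), z1, mul_zero]
    · simp only [if_neg (Ne.symm h02), z2, mul_zero]
    · simp only [if_neg (Ne.symm h03), z3, mul_zero]

/-- the periodic autocorrelation of the zero row vanishes. -/
lemma paf_of_zero_row {u : ZMod n → ℤ} (hu : ∀ x, u x = 0) (s : ZMod n) : PAF u s = 0 := by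
  unfold PAF
  exact Finset.sum_eq_zero fun x _ => by rw [hu x, zero_mul]

/-- the periodic autocorrelation of a row supported at `0` vanishes off `0`. -/
lemma paf_of_delta_row {u : ZMod n → ℤ} (hu : ∀ x, x ≠ 0 → u x = 0) {s : ZMod n} (hs : s ≠ 0) : PAF u s = 0 := by
  unfold PAF
  refine Finset.sum_eq_zero fun x _ => ?_
  by_cases hx : x = 0
  · rw [hx, zero_add, hu s hs, mul_zero]
  · rw [hu x hx, zero_mul]

/-- **structure of the transposition shape at odd order.**  If `π = (k₁ k₂)` fixes the row `k₀` through `0` and a fourth row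
`k₃`, then PARITY (`PAF(2c) ≡ t(c)² (mod 2)` for the symmetric/skew rows `k₀, k₃`; the reversal pair contributes
`2·PAF_{k₁} ≡ 0`) forces `t_{k₃} = 0` and `t_{k₀} = ±δ₀`; consequently `PAF_{t_{k₁}}(s) = 0` for all `s ≠ 0` and, by the
grammar `Σ_k (Σ t_k)² = n`, `n = 2 (Σ t_{k₁})² + 1`. -/
theorem negMultiplier_swap_structure_odd (hn : n % 2 = 1) (ht : IsTMatrixRows n t) (hε : ∀ k, ε k = 1 ∨ ε k = -1)
    (hmul : ∀ k x, t (π k) (-x) = ε k * t k x) {k₀ k₁ k₂ k₃ : Fin 4} (h10 : k₁ ≠ k₀) (h20 : k₂ ≠ k₀) (h30 : k₃ ≠ k₀)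
    (h12 : k₁ ≠ k₂) (h13 : k₁ ≠ k₃) (h23 : k₂ ≠ k₃) (hk₀ : t k₀ 0 ≠ 0) (hπ₀ : π k₀ = k₀) (c1 : π k₁ = k₂)
    (c3 : π k₃ = k₃) :
    (∀ x, t k₃ x = 0) ∧ (∀ x, x ≠ 0 → t k₀ x = 0) ∧ (∀ x, t k₂ (-x) = ε k₁ * t k₁ x) ∧
      (∀ s, s ≠ 0 → PAF (t k₁) s = 0) ∧ (n : ℤ) = 2 * (∑ x, t k₁ x) ^ 2 + 1 := by
  have r0 : ∀ x, t k₀ (-x) = ε k₀ * t k₀ x := fun x => by rw [← hmul k₀ x, hπ₀]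
  have r3 : ∀ x, t k₃ (-x) = ε k₃ * t k₃ x := fun x => by rw [← hmul k₃ x, c3]
  have r12 : ∀ x, t k₂ (-x) = ε k₁ * t k₁ x := fun x => by rw [← hmul k₁ x, c1]
  have hP12 : ∀ s, PAF (t k₂) s = PAF (t k₁) s := paf_of_signed_reversal (hε k₁) r12
  -- parity: rows `k₀` and `k₃` vanish off `0`
  have key : ∀ c : ZMod n, c ≠ 0 → t k₀ c = 0 ∧ t k₃ c = 0 := by
    intro c hc
    have hs : c + c ≠ 0 := fun h => hc (add_self_eq_zero_odd hn h)
    have hsum := ht.2 (c + c) hs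
    rw [sum_fin4_of_distinct _ (Ne.symm h10) (Ne.symm h20) (Ne.symm h30) h12 h13 h23, hP12] at hsum
    have hcast := congrArg (Int.cast : ℤ → ZMod 2) hsum
    push_cast at hcast
    rw [paf_castTwo_of_neg_rel hn (t k₀) (hε k₀) r0 c, paf_castTwo_of_neg_rel hn (t k₃) (hε k₃) r3 c] at hcast
    have h2 : ∀ z : ZMod 2, z + z = 0 := by decide
    push_cast at hcast
    have hpar : ((t k₀ c : ℤ) : ZMod 2) ^ 2 + ((t k₃ c : ℤ) : ZMod 2) ^ 2 = 0 := by
      have e : ((t k₀ c : ℤ) : ZMod 2) ^ 2 + (PAF (t k₁) (c + c) : ZMod 2) + (PAF (t k₁) (c + c) : ZMod 2) +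
          ((t k₃ c : ℤ) : ZMod 2) ^ 2 = ((t k₀ c : ℤ) : ZMod 2) ^ 2 + ((t k₃ c : ℤ) : ZMod 2) ^ 2 +
          ((PAF (t k₁) (c + c) : ZMod 2) + (PAF (t k₁) (c + c) : ZMod 2)) := by ring
      rw [e, h2, add_zero] at hcast
      exact hcast
    obtain ⟨k, hk, hz⟩ := ht.1 c
    have hk0 : k ≠ k₀ := by
      rintro rfl
      rw [hz k₃ h30] at hpar
      rcases hk with e | e <;> rw [e] at hpar <;> exact absurd hpar (by decide)
    have hk3 : k ≠ k₃ := by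
      rintro rfl
      rw [hz k₀ (Ne.symm h30)] at hpar
      rcases hk with e | e <;> rw [e] at hpar <;> exact absurd hpar (by decide)
    exact ⟨hz k₀ (Ne.symm hk0), hz k₃ (Ne.symm hk3)⟩
  -- the row `k₃` also vanishes at `0`
  obtain ⟨k', -, hz0⟩ := ht.1 0
  have hk' : k₀ = k' := by
    by_contra hne
    exact hk₀ (hz0 k₀ hne)
  have h3zero : ∀ x, t k₃ x = 0 := fun x => by
    by_cases hx : x = 0
    · rw [hx]; exact hz0 k₃ (by rw [← hk']; exact h30)
    · exact (key x hx).2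
  have h0delta : ∀ x, x ≠ 0 → t k₀ x = 0 := fun x hx => (key x hx).1
  -- `PAF_{k₁}` vanishes off `0`
  have hpaf1 : ∀ s, s ≠ 0 → PAF (t k₁) s = 0 := by
    intro s hs
    have hsum := ht.2 s hs
    rw [sum_fin4_of_distinct _ (Ne.symm h10) (Ne.symm h20) (Ne.symm h30) h12 h13 h23, hP12, paf_of_delta_row h0delta hs,
      paf_of_zero_row h3zero] at hsum
    linarith
  refine ⟨h3zero, h0delta, r12, hpaf1, ?_⟩
  -- the grammar
  have hgram := tmatrixRows_sum_sq ht
  rw [sum_fin4_of_distinct _ (Ne.symm h10) (Ne.symm h20) (Ne.symm h30) h12 h13 h23] at hgram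
  have hS0 : ∑ x, t k₀ x = t k₀ 0 := by
    rw [Finset.sum_eq_single (0 : ZMod n) (fun x _ hx => h0delta x hx) fun h => absurd (mem_univ _) h]
  have hS0sq : (∑ x, t k₀ x) ^ 2 = 1 := by
    rw [hS0]
    rcases tmatrixRows_entry ht k₀ 0 with e | e | e
    · exact absurd e hk₀
    · rw [e]; norm_num
    · rw [e]; norm_num
  have hS3 : ∑ x, t k₃ x = 0 := Finset.sum_eq_zero fun x _ => h3zero x
  have hS2 : (∑ x, t k₂ x) ^ 2 = (∑ x, t k₁ x) ^ 2 := by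
    rw [← c1]; exact rowSum_sq_perm_of_negMultiplier hε hmul k₁
  rw [hS0sq, hS2, hS3] at hgram
  linarith

/-- **classification at odd order `n > 1`.**  First rows of circulant T-matrices of odd order `n > 1` with a signed/permuted
multiplier `-1` have the shape `(±δ₀, t, ε t*, 0)`: `π` is a transposition `(k₁ k₂)`, the row through `0` is `±δ₀`, the fourth
row vanishes, `t_{k₂}(-x) = ε_{k₁} t_{k₁}(x)`, `t_{k₁}` has perfect periodic autocorrelation off `0`, and `n = 2 (Σ t_{k₁})² + 1`. -/
theorem negMultiplier_odd_classification (hn : n % 2 = 1) (h1 : 1 < n) (ht : IsTMatrixRows n t)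
    (hε : ∀ k, ε k = 1 ∨ ε k = -1) (hmul : ∀ k x, t (π k) (-x) = ε k * t k x) :
    ∃ k₀ k₁ k₂ k₃ : Fin 4, k₁ ≠ k₀ ∧ k₂ ≠ k₀ ∧ k₃ ≠ k₀ ∧ k₁ ≠ k₂ ∧ k₁ ≠ k₃ ∧ k₂ ≠ k₃ ∧
      π = Equiv.swap k₁ k₂ ∧ t k₀ 0 ≠ 0 ∧ (∀ x, x ≠ 0 → t k₀ x = 0) ∧ (∀ x, t k₃ x = 0) ∧
      (∀ x, t k₂ (-x) = ε k₁ * t k₁ x) ∧ (∀ s, s ≠ 0 → PAF (t k₁) s = 0) ∧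
      (n : ℤ) = 2 * (∑ x, t k₁ x) ^ 2 + 1 := by
  obtain ⟨k₀, hk₀, hz0⟩ := ht.1 0
  have hk₀ne : t k₀ 0 ≠ 0 := by rcases hk₀ with e | e <;> simp [e]
  obtain ⟨hπ₀, -⟩ := fixed_of_negMultiplier ht hε hmul hk₀ne
  rcases perm_fin4_fixing_trichotomy π k₀ hπ₀ with hall | ⟨k₁, k₂, k₃, -, -, -, -, h13, -, c1, c2, c3⟩ |
      ⟨k₁, k₂, k₃, h10, h20, h30, h12, h13, h23, c1, c2, c3⟩
  · exact (no_signedSymmetric_tMatrixRows_odd hn h1 ht hε fun k x => by rw [← hmul k x, hall k]).elim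
  · exact (no_threeCycle_negMultiplier_odd hn h1 ht hε hmul h13 c1 c2 c3).elim
  · obtain ⟨h3, h0, r12, hpaf, hnum⟩ :=
      negMultiplier_swap_structure_odd hn ht hε hmul h10 h20 h30 h12 h13 h23 hk₀ne hπ₀ c1 c3
    refine ⟨k₀, k₁, k₂, k₃, h10, h20, h30, h12, h13, h23, ?_, hk₀ne, h0, h3, r12, hpaf, hnum⟩
    ext k
    rcases fin4_eq_of_distinct (Ne.symm h10) (Ne.symm h20) (Ne.symm h30) h12 h13 h23 k with rfl | rfl | rfl | rfl
    · rw [hπ₀, Equiv.swap_apply_of_ne_of_ne (Ne.symm h10) (Ne.symm h20)]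
    · rw [c1, Equiv.swap_apply_left]
    · rw [c2, Equiv.swap_apply_right]
    · rw [c3, Equiv.swap_apply_of_ne_of_ne (Ne.symm h13) (Ne.symm h23)]

/-- **the order condition**: circulant T-matrices of odd order `n > 1` with a signed/permuted multiplier `-1` exist only
for `n = 2a² + 1` (`n ∈ {3, 9, 19, 33, 51, 73, 99, 129, 163, 201, …}`). -/
theorem negMultiplier_odd_order (hn : n % 2 = 1) (h1 : 1 < n) (ht : IsTMatrixRows n t)
    (hε : ∀ k, ε k = 1 ∨ ε k = -1) (hmul : ∀ k x, t (π k) (-x) = ε k * t k x) :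
    ∃ a : ℤ, (n : ℤ) = 2 * a ^ 2 + 1 := by
  obtain ⟨-, k₁, -, -, -, -, -, -, -, -, -, -, -, -, -, -, hnum⟩ := negMultiplier_odd_classification hn h1 ht hε hmul
  exact ⟨_, hnum⟩

/-- **second proof at `167`** (table-free): `166 = 2a²` has no integer solution (`83` is not a square). -/
theorem no_negMultiplier_tMatrixRows_167' :
    ¬ ∃ (t : Fin 4 → ZMod 167 → ℤ) (π : Equiv.Perm (Fin 4)) (ε : Fin 4 → ℤ),
      IsTMatrixRows 167 t ∧ (∀ k, ε k = 1 ∨ ε k = -1) ∧ ∀ k x, t (π k) (-x) = ε k * t k x := by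
  rintro ⟨t, π, ε, ht, hε, hmul⟩
  obtain ⟨a, ha⟩ := negMultiplier_odd_order (n := 167) (by norm_num) (by norm_num) ht hε hmul
  push_cast at ha
  have h83 : a ^ 2 = 83 := by linarith
  have hN : a.natAbs ^ 2 = 83 := by
    have e : ((a.natAbs : ℤ)) ^ 2 = 83 := by rw [Int.natAbs_pow_two]; exact h83
    exact_mod_cast e
  have hlt : a.natAbs < 10 := by nlinarith [hN]
  have key : ∀ m ∈ Finset.range 10, m ^ 2 ≠ 83 := by decide
  exact key _ (Finset.mem_range.mpr hlt) hN

end OddOrder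

/-! ## §16 The converse: perfect half-sequences give the residual shape -/
section Converse

variable {n : ℕ} [NeZero n]

/-- **sufficiency.**  A `±1`-function `u` on a half-set (`u(0) = 0`; for `x ≠ 0` exactly one of `u(x), u(-x)` is non-zero)
with perfect periodic autocorrelation (`PAF_u(s) = 0`, `s ≠ 0`) gives first rows of circulant T-matrices `(δ₀, u, u*, 0)`
(`u*(x) = u(-x)`) carrying the multiplier `-1` with `π = (1 2)`, all signs `+`. -/
theorem tmatrixRows_of_perfect_halfSeq {u : ZMod n → ℤ} (hu0 : u 0 = 0)
    (hhalf : ∀ x, x ≠ 0 → ((u x = 1 ∨ u x = -1) ∧ u (-x) = 0) ∨ (u x = 0 ∧ (u (-x) = 1 ∨ u (-x) = -1)))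
    (hpaf : ∀ s, s ≠ 0 → PAF u s = 0) :
    IsTMatrixRows n ![fun x => if x = 0 then 1 else 0, u, fun x => u (-x), fun _ => 0] ∧
      ∀ k x, (![fun x => if x = 0 then 1 else 0, u, fun x => u (-x), fun _ => 0] : Fin 4 → ZMod n → ℤ)
        ((Equiv.swap 1 2 : Equiv.Perm (Fin 4)) k) (-x) =
        1 * (![fun x => if x = 0 then 1 else 0, u, fun x => u (-x), fun _ => 0] : Fin 4 → ZMod n → ℤ) k x := by
  refine ⟨⟨fun x => ?_, fun s hs => ?_⟩, fun k x => ?_⟩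
  · -- one non-zero entry per position
    by_cases hx : x = 0
    · subst hx
      refine ⟨0, by simp, fun k' hk' => ?_⟩
      fin_cases k' <;> simp_all
    · rcases hhalf x hx with ⟨h1, h2⟩ | ⟨h1, h2⟩
      · refine ⟨1, by simpa using h1, fun k' hk' => ?_⟩
        fin_cases k' <;> simp_all
      · refine ⟨2, by simpa using h2, fun k' hk' => ?_⟩
        fin_cases k' <;> simp_all
  · -- autocorrelations: δ + PAF u + PAF u* + 0
    have hPstar : PAF (fun x => u (-x)) s = PAF u s :=
      paf_of_signed_reversal (t := u) (ε := 1) (Or.inl rfl) (fun x => by rw [neg_neg, one_mul]) s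
    have hPdelta : PAF (fun x : ZMod n => if x = 0 then (1 : ℤ) else 0) s = 0 :=
      paf_of_delta_row (fun x hx => if_neg hx) hs
    have hPzero : PAF (fun _ : ZMod n => (0 : ℤ)) s = 0 := paf_of_zero_row (fun _ => rfl) s
    simp only [Fin.sum_univ_four, Matrix.cons_val_zero, Matrix.cons_val_one, Matrix.cons_val]
    rw [hPdelta, hPstar, hpaf s hs, hPzero]
    norm_num
  · -- the symmetry with `π = (1 2)`, `ε ≡ 1`
    fin_cases k
    · simp [Equiv.swap_apply_of_ne_of_ne]
    · simp
    · simp [Equiv.swap_apply_right]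
    · simp [Equiv.swap_apply_of_ne_of_ne]

/-- the order-`3` example `(δ₀, δ₁, δ₂, 0)`: T-matrix rows of order `3 = 2·1² + 1` with the reversal symmetry swapping the
middle two rows (kernel check by `decide`). -/
theorem tmatrixRows_three_example :
    IsTMatrixRows 3 ![fun x => if x = 0 then 1 else 0, fun x => if x = 1 then 1 else 0,
        fun x => if x = 2 then 1 else 0, fun _ => 0] ∧
      ∀ (k : Fin 4) (x : ZMod 3),
        (![fun x => if x = 0 then 1 else 0, fun x => if x = 1 then 1 else 0, fun x => if x = 2 then 1 else 0, fun _ => 0] :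
            Fin 4 → ZMod 3 → ℤ) ((Equiv.swap 1 2 : Equiv.Perm (Fin 4)) k) (-x) =
          1 * (![fun x => if x = 0 then 1 else 0, fun x => if x = 1 then 1 else 0, fun x => if x = 2 then 1 else 0,
            fun _ => 0] : Fin 4 → ZMod 3 → ℤ) k x := by
  constructor
  · constructor <;> decide
  · decide

end Converse

/-! ## §17 Aperiodic corollary at odd length: reversal symmetries of T-sequences -/
section ReversalOdd

variable {n : ℕ} [NeZero n]

/-- reading a reversal relation periodically at odd length `n` with midpoint `m = (n-1)/2`:
`(-x + m).val = n - 1 - (x + m).val`. -/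
lemma val_neg_add_mid (hn : n % 2 = 1) (x : ZMod n) :
    (-x + (((n - 1) / 2 : ℕ) : ZMod n)).val = n - 1 - (x + (((n - 1) / 2 : ℕ) : ZMod n)).val := by
  have hlt : (x + (((n - 1) / 2 : ℕ) : ZMod n)).val < n := ZMod.val_lt _
  have hcast : (-x + (((n - 1) / 2 : ℕ) : ZMod n)) =
      ((n - 1 - (x + (((n - 1) / 2 : ℕ) : ZMod n)).val : ℕ) : ZMod n) := by
    rw [Nat.cast_sub (by omega), ZMod.natCast_zmod_val]
    have h2 : ((n - 1 : ℕ) : ZMod n) = (((n - 1) / 2 : ℕ) : ZMod n) + (((n - 1) / 2 : ℕ) : ZMod n) := by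
      rw [← Nat.cast_add]
      congr 1
      omega
    rw [h2]
    ring
  rw [hcast, ZMod.val_natCast, Nat.mod_eq_of_lt (by omega)]

/-- **reversal symmetries of T-sequences of odd length force `n = 2a² + 1`**: if T-sequences `t` of odd length `n > 1`
satisfy `t_{π k}(n - 1 - i) = ε_k t_k(i)` (`i < n`), then `n = 2a² + 1` for an integer `a` (periodise and translate by the
midpoint; `negMultiplier_odd_order`). -/
theorem reversal_tSeq_odd_order (hn : n % 2 = 1) (h1 : 1 < n) {t : Fin 4 → ℕ → ℤ} (ht : IsTSeq n t)
    {π : Equiv.Perm (Fin 4)} {ε : Fin 4 → ℤ} (hε : ∀ k, ε k = 1 ∨ ε k = -1)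
    (hrev : ∀ k, ∀ i < n, t (π k) (n - 1 - i) = ε k * t k i) : ∃ a : ℤ, (n : ℤ) = 2 * a ^ 2 + 1 := by
  set m : ZMod n := (((n - 1) / 2 : ℕ) : ZMod n) with hm
  set u : Fin 4 → ZMod n → ℤ := fun k x => periodize n (t k) (x + m) with hu
  have hut : IsTMatrixRows n u := tmatrixRows_translate (tseq_tmatrixRows ht) m
  have hmul : ∀ k x, u (π k) (-x) = ε k * u k x := fun k x => by
    simp only [hu, periodize]
    show t (π k) (-x + m).val = ε k * t k (x + m).val
    rw [hm, val_neg_add_mid hn]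
    exact hrev k _ (ZMod.val_lt _)
  exact negMultiplier_odd_order hn h1 hut hε hmul

/-- **no T-sequences of odd length `n > 1` with every sequence reversal-symmetric or reversal-skew**
(`t_k(n - 1 - i) = ± t_k(i)`, one sign per sequence). -/
theorem no_reversalSymmetric_tSeq_odd (hn : n % 2 = 1) (h1 : 1 < n) :
    ¬ ∃ (t : Fin 4 → ℕ → ℤ) (ε : Fin 4 → ℤ), IsTSeq n t ∧ (∀ k, ε k = 1 ∨ ε k = -1) ∧
      ∀ k, ∀ i < n, t k (n - 1 - i) = ε k * t k i := by
  rintro ⟨t, ε, ht, hε, hrev⟩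
  set m : ZMod n := (((n - 1) / 2 : ℕ) : ZMod n) with hm
  set u : Fin 4 → ZMod n → ℤ := fun k x => periodize n (t k) (x + m) with hu
  have hut : IsTMatrixRows n u := tmatrixRows_translate (tseq_tmatrixRows ht) m
  have hsym : ∀ k x, u k (-x) = ε k * u k x := fun k x => by
    simp only [hu, periodize]
    show t k (-x + m).val = ε k * t k (x + m).val
    rw [hm, val_neg_add_mid hn]
    exact hrev k _ (ZMod.val_lt _)
  exact no_signedSymmetric_tMatrixRows_odd hn h1 hut hε hsym

end ReversalOdd

/-! ## §18 Sanity pair at order 5: T-sequences exist, symmetric ones do not -/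

/-- (+) sanity: T-sequences of length `5` exist — Seberry–Yamada Example 1.28, `{10000}, {01100}, {0001-}, {00000}`
(kernel check by `decide`). -/
theorem tseq_five_example :
    IsTSeq 5 ![fun i => if i = 0 then 1 else 0, fun i => if i = 1 ∨ i = 2 then 1 else 0,
      fun i => if i = 3 then 1 else if i = 4 then -1 else 0, fun _ => (0 : ℤ)] := by
  constructor <;> decide

/-- (−) sanity: but NO circulant T-matrices of order `5` carry a signed/permuted multiplier `-1` (`5 ≠ 2a² + 1`). -/
theorem no_negMultiplier_tMatrixRows_five :
    ¬ ∃ (t : Fin 4 → ZMod 5 → ℤ) (π : Equiv.Perm (Fin 4)) (ε : Fin 4 → ℤ),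
      IsTMatrixRows 5 t ∧ (∀ k, ε k = 1 ∨ ε k = -1) ∧ ∀ k x, t (π k) (-x) = ε k * t k x := by
  rintro ⟨t, π, ε, ht, hε, hmul⟩
  obtain ⟨a, ha⟩ := negMultiplier_odd_order (n := 5) (by norm_num) (by norm_num) ht hε hmul
  push_cast at ha
  have h2 : a ^ 2 = 2 := by linarith
  have hN : a.natAbs ^ 2 = 2 := by
    have e : ((a.natAbs : ℤ)) ^ 2 = 2 := by rw [Int.natAbs_pow_two]; exact h2
    exact_mod_cast e
  have hlt : a.natAbs < 2 := by nlinarith [hN]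
  have key : ∀ m ∈ Finset.range 2, m ^ 2 ≠ 2 := by decide
  exact key _ (Finset.mem_range.mpr hlt) hN

end Summit.Ventures.DiscreteObjects.Hadamard
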